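import Literature.Probability.RandomPlanarGeometry.SLEKappaRho
import Literature.Probability.RandomPlanarGeometry.LoewnerHullConnected
import Literature.Probability.RandomPlanarGeometry.LoewnerRealPointProofs
import Literature.Probability.RandomPlanarGeometry.LoewnerDriverStability
import Literature.Probability.Process.PathSpaceBorel
import HarnessLib

/-!
# The closure of the union of the Loewner hulls: connectedness, and measurability of its avoidance events

Deterministic Loewner-chain input for the decomposition of the named fact
`Literature.Probability.RandomPlanarGeometry.SLEKappaRho.exists_measurable_fill_version`
(file `SLEKappaRho`: "`K = F^{ℝ₊}_ℍ(cl K_∞)` of SLE(8/3, ρ) is a random element of `Ω₊`",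
[LSW] Thm. 8.4 with §8.1), after

* G. F. Lawler, O. Schramm, W. Werner, *Conformal restriction: the chordal case*, J. Amer. Math.
  Soc. **16** (2003) 917–955, arXiv:math/0209343 (**[LSW]**), Lemma 8.3 (p. 36:
  "`K_∞ := ⋃_{t>0} K_t`") and Thm. 8.4 (p. 37: "`K = F^{ℝ₊}_ℍ(cl K_∞)`"),
* G. F. Lawler, *Conformally Invariant Processes in the Plane*, AMS (2005), Ch. 4 §4.1 (hulls of
  a continuous driving function), §4.7 (continuity in the driving function).

For the chordal Loewner chain of a CONTINUOUS driving function `W` (`LoewnerChain`; hulls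
`K_t = Loewner.hull W t ⊆ ℍ`, closed hulls `K̂_t = Loewner.closedHull W t = {z ∈ ℍ̄ : T_z ≤ t}`,
`K_∞ = Loewner.hullUnion W = ⋃_t K_t`), all PROVED:

* `Loewner.isConnected_closedHull` — **`K̂_t` is connected**: no part of it floats in `ℍ`
  (`isPreconnected_closedHull_union_im_nonpos`, `LoewnerHullConnected`) and its real trace
  `{x : T_x ≤ t}` is an interval through `W 0` (monotonicity of `x ↦ T_x` on either side of the
  driving point, `swallowingTime_mono_right/left`);
* `Loewner.closedHull_eq_closure_hull` — `K̂_t = cl K_t` for `t > 0` (swallowed real points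
  are limits of hull points, `LoewnerRealPoint(Proofs)`; `W 0 ∈ cl K_t`, Lawler's Lemma 4.13);
* `Loewner.isConnected_closure_hullUnion`, `Loewner.ofReal_driving_mem_closure_hullUnion`,
  `Loewner.closure_hullUnion_subset` — **`cl K_∞` is connected, contains `W 0`, lies in `ℍ̄`**
  (`cl K_∞ = cl ⋃_{t>0} K̂_t`, an increasing union of connected sets through `W 0`);
* `Loewner.isOpen_setOf_disjoint_hull` — for a compact `C ⊆ ℍ`, **the set of continuous
  driving functions `U` with `K_t(U) ∩ C = ∅` is open** in `C(ℝ≥0, ℝ)` (compact-open topology =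
  locally uniform convergence): every `z ∈ C` flows beyond `t` at a positive distance from `U₀`,
  so by the two-driver tube estimate (`Loewner.dist_map_le_of_driving_close`,
  `LoewnerDriverStability`; Lawler §4.7) nearby points flow beyond `t` for uniformly nearby
  drivers, and `C` is compact;
* `Loewner.measurableSet_setOf_disjoint_hull`,
  `Loewner.measurableSet_setOf_disjoint_closure_hullUnion` — hence, for any family of continuous
  driving functions `Φ ω` depending measurably on `ω` through its values (a random element of
  path space, `Literature.Probability.Process.measurable_continuousMap_of_eval`, `PathSpaceBorel`),
  **the avoidance events `{ω | K_t(Φ ω) ∩ C = ∅}` (`C ⊆ ℍ` compact) and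
  `{ω | cl K_∞(Φ ω) ∩ A = ∅}` (`A` compact) are measurable** — the latter is
  `⋃ₙ ⋂ₖ ⋂ⱼ {K_k ∩ C^{n}_j = ∅}` for compact exhaustions `(C^{n}_j)_j` of the open sets
  `(A)_{1/(n+1)} ∩ ℍ`. This is the measurability half of "`K` is a random element of `Ω₊`" in
  [LSW] Thm. 8.4, for hulls not known to be generated by a curve.

Mathlib: `ContinuousMap.hasBasis_compactConvergenceUniformity`, `UniformSpace.ball_mem_nhds`,
`IsCompact.elim_nhds_subcover`, `IsOpen.exists_iUnion_isClosed`,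
`IsCompact.exists_thickening_subset_open`, `Set.OrdConnected.isPreconnected`,
`isPreconnected_of_forall`.
-/

noncomputable section

open Set Filter Topology Metric MeasureTheory Complex
open UpperHalfPlane (upperHalfPlaneSet isOpen_upperHalfPlaneSet)
open scoped NNReal

namespace Literature.Probability.RandomPlanarGeometry

namespace Loewner

variable {W : ℝ≥0 → ℝ}

/-! ### The closed hull is connected -/

/-- **The real trace `{x : T_x ≤ t}` of the closed hull is an interval** (it contains `W 0`, and
`x ↦ T_x` is monotone on either side of `W 0`). [cite: Lawler2005, Ch. 4 §4.1 (p. 96: `K̄_t ∩ ℝ` is an interval)] -/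
theorem ordConnected_setOf_swallowingTime_le (hW : Continuous W) (t : ℝ≥0) :
    OrdConnected {x : ℝ | swallowingTime W x ≤ (t : WithTop ℝ≥0)} := by
  refine ⟨fun x hx z hz y hy ↦ ?_⟩
  rcases lt_trichotomy y (W 0) with h | h | h
  · exact (swallowingTime_mono_left hW h hy.1).trans hx
  · rw [mem_setOf_eq, h]
    exact (swallowingTime_driving_le W).trans bot_le
  · exact (swallowingTime_mono_right hW h hy.2).trans hz

/-- The driving point belongs to every closed hull. [folklore] -/
theorem ofReal_driving_mem_closedHull (W : ℝ≥0 → ℝ) (t : ℝ≥0) : ((W 0 : ℝ) : ℂ) ∈ closedHull W t :=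
  ⟨by simp, (swallowingTime_driving_le W).trans bot_le⟩

/-- A point of the closed hull off the open half-plane is a swallowed real point. [folklore] -/
theorem mem_image_ofReal_of_mem_closedHull {t : ℝ≥0} {z : ℂ} (hz : z ∈ closedHull W t)
    (hzim : z.im ≤ 0) :
    z ∈ ((↑) : ℝ → ℂ) '' {x : ℝ | swallowingTime W x ≤ (t : WithTop ℝ≥0)} := by
  have him : z.im = 0 := le_antisymm hzim hz.1
  have hzre : ((z.re : ℝ) : ℂ) = z := Complex.ext (by simp) (by simp [him])
  refine ⟨z.re, ?_, hzre⟩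
  show swallowingTime W ((z.re : ℝ) : ℂ) ≤ t
  rw [hzre]
  exact hz.2

/-- **The closed Loewner hull `K̂_t` is connected** (continuous driving function): its real trace
is an interval through `W 0`, and no part of `K̂_t` floats in `ℍ`
(`isPreconnected_closedHull_union_im_nonpos`). [cite: Lawler2005, Ch. 4 §4.1 (compact ℍ-hulls K_t)] -/
theorem isConnected_closedHull (hW : Continuous W) (t : ℝ≥0) : IsConnected (closedHull W t) := by
  set Rt : Set ℂ := ((↑) : ℝ → ℂ) '' {x : ℝ | swallowingTime W x ≤ (t : WithTop ℝ≥0)} with hRt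
  have hRtc : IsPreconnected Rt :=
    (ordConnected_setOf_swallowingTime_le hW t).isPreconnected.image _
      Complex.continuous_ofReal.continuousOn
  have hRsub : Rt ⊆ closedHull W t := by
    rintro _ ⟨x, hx, rfl⟩
    exact ⟨by simp, hx⟩
  refine ⟨⟨_, ofReal_driving_mem_closedHull W t⟩, ?_⟩
  rw [isPreconnected_iff_subset_of_disjoint_closed]
  intro u v hu hv hcover hdisj
  -- the real trace lies in `u` or in `v`; by symmetry in `u`
  have hRuv : Rt ⊆ u ∨ Rt ⊆ v := by
    refine isPreconnected_iff_subset_of_disjoint_closed.1 hRtc u v hu hv (hRsub.trans hcover) ?_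
    rw [← subset_empty_iff, ← hdisj]
    exact inter_subset_inter_left _ hRsub
  wlog hRu : Rt ⊆ u generalizing u v
  · exact (this v u hv hu (by rwa [union_comm v u]) (by rwa [inter_comm v u]) hRuv.symm
      (hRuv.resolve_left hRu)).symm
  left
  -- connectedness of `K̂_t ∪ {im ≤ 0}` with the closed cover `u ∪ {im ≤ 0}`, `v ∩ K̂_t`
  set L : Set ℂ := {z : ℂ | z.im ≤ 0} with hL
  have hLc : IsClosed L := isClosed_le Complex.continuous_im continuous_const
  have hKc : IsClosed (closedHull W t) := isClosed_closedHull hW t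
  have h := isPreconnected_closedHull_union_im_nonpos hW t
  rw [isPreconnected_iff_subset_of_disjoint_closed] at h
  have hcov : closedHull W t ∪ L ⊆ (u ∪ L) ∪ (v ∩ closedHull W t) := by
    rintro z (hz | hz)
    · rcases hcover hz with h' | h'
      · exact Or.inl (Or.inl h')
      · exact Or.inr ⟨h', hz⟩
    · exact Or.inl (Or.inr hz)
  have hdis : (closedHull W t ∪ L) ∩ ((u ∪ L) ∩ (v ∩ closedHull W t)) = ∅ := by
    refine eq_empty_of_forall_notMem fun z hz ↦ ?_
    obtain ⟨-, hzuL, hzv, hzK⟩ := hz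
    have hzu : z ∈ u := by
      rcases hzuL with hzu | hzL
      · exact hzu
      · exact hRu (mem_image_ofReal_of_mem_closedHull hzK hzL)
    have : z ∈ closedHull W t ∩ (u ∩ v) := ⟨hzK, hzu, hzv⟩
    rw [hdisj] at this
    exact this
  rcases h _ _ (hu.union hLc) (hv.inter hKc) hcov hdis with h' | h'
  · intro z hz
    rcases h' (Or.inl hz) with h'' | h''
    · exact h''
    · exact hRu (mem_image_ofReal_of_mem_closedHull hz h'')
  · exfalso
    have hI : (-I : ℂ) ∈ closedHull W t ∪ L := Or.inr (by simp [hL])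
    have := (h' hI).2.1
    norm_num at this

/-! ### The closed hull is the closure of the hull -/

/-- **`K̂_t = cl K_t` for `t > 0`**: the closed hull is closed and contains `K_t`; conversely its
real points are limits of hull points — swallowed real points `x ≠ W 0` by Lawler's reflection
remark (`mem_closure_hull_of_swallowingTime_le`, `LoewnerRealPoint(Proofs)`), and `W 0` by
Lawler's Lemma 4.13 (`driving_mem_closure_hull`). [cite: Lawler2005, Ch. 4 §4.1 p. 96 and Rem. 6.6 p. 148] -/
theorem closedHull_eq_closure_hull (hW : Continuous W) {t : ℝ≥0} (ht : 0 < t) :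
    closedHull W t = closure (hull W t) := by
  refine Subset.antisymm (fun z hz ↦ ?_)
    ((isClosed_closedHull hW t).closure_subset_iff.2 (hull_subset_closedHull W t))
  rcases mem_closedHull_iff.1 hz with h | ⟨him, hT⟩
  · exact subset_closure h
  · have hzre : ((z.re : ℝ) : ℂ) = z := Complex.ext (by simp) (by simp [him])
    by_cases hz0 : z = W 0
    · rw [hz0]
      exact driving_mem_closure_hull hW ht
    · rw [← hzre] at hz0 hT ⊢
      exact mem_closure_hull_of_swallowingTime_le lt_swallowingTime_of_notMem_closure_hull_holds
        hW hz0 hT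

/-! ### The closure of `K_∞` -/

/-- `K_∞ ⊆ ⋃_{t > 0} K̂_t`. [folklore] -/
theorem hullUnion_subset_iUnion_closedHull (W : ℝ≥0 → ℝ) :
    hullUnion W ⊆ ⋃ t ∈ Ioi (0 : ℝ≥0), closedHull W t := by
  intro z hz
  obtain ⟨t, hzt⟩ := mem_iUnion.1 hz
  refine mem_iUnion₂.2 ⟨t + 1, by simp, hull_subset_closedHull W (t + 1) ?_⟩
  exact hull_mono W (by simp) hzt

/-- `⋃_{t > 0} K̂_t ⊆ cl K_∞` (continuous driving function). [folklore] -/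
theorem iUnion_closedHull_subset_closure_hullUnion (hW : Continuous W) :
    ⋃ t ∈ Ioi (0 : ℝ≥0), closedHull W t ⊆ closure (hullUnion W) := by
  intro z hz
  obtain ⟨t, ht, hzt⟩ := mem_iUnion₂.1 hz
  rw [closedHull_eq_closure_hull hW (mem_Ioi.1 ht)] at hzt
  exact closure_mono (subset_iUnion (hull W) t) hzt

/-- **`cl K_∞ = cl ⋃_{t > 0} K̂_t`.** [folklore] -/
theorem closure_hullUnion_eq (hW : Continuous W) :
    closure (hullUnion W) = closure (⋃ t ∈ Ioi (0 : ℝ≥0), closedHull W t) :=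
  Subset.antisymm (closure_mono (hullUnion_subset_iUnion_closedHull W))
    (isClosed_closure.closure_subset_iff.2 (iUnion_closedHull_subset_closure_hullUnion hW))

/-- `⋃_{t > 0} K̂_t` is preconnected (connected sets through the common point `W 0`). [folklore] -/
theorem isPreconnected_iUnion_closedHull (hW : Continuous W) :
    IsPreconnected (⋃ t ∈ Ioi (0 : ℝ≥0), closedHull W t) := by
  refine isPreconnected_of_forall ((W 0 : ℝ) : ℂ) fun y hy ↦ ?_
  obtain ⟨t, ht, hyt⟩ := mem_iUnion₂.1 hy
  exact ⟨closedHull W t, subset_iUnion₂ (s := fun t _ ↦ closedHull W t) t ht,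
    ofReal_driving_mem_closedHull W t, hyt, (isConnected_closedHull hW t).isPreconnected⟩

/-- **`W 0 ∈ cl K_∞`.** [cite: Lawler2005, Lemma 4.13] -/
theorem ofReal_driving_mem_closure_hullUnion (hW : Continuous W) :
    ((W 0 : ℝ) : ℂ) ∈ closure (hullUnion W) :=
  closure_mono (subset_iUnion (hull W) 1) (driving_mem_closure_hull hW one_pos)

/-- **`cl K_∞` is connected** for a continuous driving function ([LSW] Thm. 8.4 treats
`F^{ℝ₊}_ℍ(cl K_∞)` as an element of `Ω₊`, in particular connected).
[cite: LawlerSchrammWerner2003Restriction, Thm. 8.4 (p. 37) with §8.1 (p. 31)] -/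
theorem isConnected_closure_hullUnion (hW : Continuous W) : IsConnected (closure (hullUnion W)) := by
  refine ⟨⟨_, ofReal_driving_mem_closure_hullUnion hW⟩, ?_⟩
  rw [closure_hullUnion_eq hW]
  exact (isPreconnected_iUnion_closedHull hW).closure

/-- `cl K_∞ ⊆ ℍ̄`. [folklore] -/
theorem closure_hullUnion_subset (W : ℝ≥0 → ℝ) : closure (hullUnion W) ⊆ {z : ℂ | 0 ≤ z.im} := by
  have hcl : closure (hullUnion W) ⊆ closure {z : ℂ | 0 ≤ z.im} :=
    closure_mono fun w hw ↦ (show 0 < w.im from hullUnion_subset _ hw).le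
  rwa [(isClosed_le continuous_const Complex.continuous_im).closure_eq] at hcl

/-- `K_∞` avoids a set iff all the hulls at natural times do (the hulls increase). [folklore] -/
theorem disjoint_hullUnion_iff {X : Set ℂ} :
    Disjoint (hullUnion W) X ↔ ∀ k : ℕ, Disjoint (hull W k) X := by
  constructor
  · exact fun h k ↦ h.mono_left (subset_iUnion (hull W) (k : ℝ≥0))
  · intro h
    refine Set.disjoint_left.2 fun z hz hzX ↦ ?_
    obtain ⟨t, hzt⟩ := mem_iUnion.1 hz
    exact Set.disjoint_left.1 (h ⌈(t : ℝ)⌉₊) (hull_mono W (by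
      rw [← NNReal.coe_le_coe, NNReal.coe_natCast]
      exact Nat.le_ceil _) hzt) hzX

/-! ### Driving functions whose hull avoids a compact set form an open set -/

/-- **Openness of hull avoidance in the driving function.** For a compact `C ⊆ ℍ` and a time
`t`, the set of continuous driving functions `U` with `K_t(U) ∩ C = ∅` is open in `C(ℝ≥0, ℝ)`
(topology of locally uniform convergence): each `z ∈ C` flows beyond `t` for `U₀` at distance
`≥ δ_z` from it, so (two-driver tube estimate, `dist_map_le_of_driving_close`) all points within
`ε_z = δ_z/(8 e^{K_z t})` of `z` flow beyond `t` for every continuous `U` within `ε_z` of `U₀` on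
`[0, t]`; cover `C` by finitely many such discs. [cite: Lawler2005, Ch. 4 §4.7 (Prop. 4.47)] -/
theorem isOpen_setOf_disjoint_hull {C : Set ℂ} (hC : IsCompact C) (hCH : C ⊆ upperHalfPlaneSet)
    (t : ℝ≥0) : IsOpen {U : C(ℝ≥0, ℝ) | Disjoint (hull U t) C} := by
  rw [isOpen_iff_mem_nhds]
  intro U₀ hU₀
  have hU₀c : Continuous U₀ := U₀.continuous
  -- every `z ∈ C` flows beyond `t`, robustly in `(z, U)`
  have key : ∀ z ∈ C, ∃ ε > (0 : ℝ), ∀ U : C(ℝ≥0, ℝ), (∀ s : ℝ≥0, s ≤ t → |U₀ s - U s| ≤ ε) →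
      ∀ z' : ℂ, dist z' z < ε → (t : WithTop ℝ≥0) < swallowingTime U z' := by
    intro z hz
    have hzt : (t : WithTop ℝ≥0) < swallowingTime U₀ z := by
      by_contra h
      exact Set.disjoint_left.1 hU₀ ⟨hCH hz, not_lt.1 h⟩ hz
    have hz0 : z ≠ U₀ 0 := ne_driving_of_lt_swallowingTime hzt
    obtain ⟨g, hg⟩ := exists_isSolution_swallowingTime_holds hU₀c hz0
    have htT : (((t : ℝ)).toNNReal : WithTop ℝ≥0) < swallowingTime U₀ z := by
      rwa [Real.toNNReal_coe]
    obtain ⟨δ, hδ, hfar⟩ := hg.exists_le_norm_sub hU₀c t.coe_nonneg htT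
    have hδ' : (0 : ℝ) < δ := hδ
    have hfar' : ∀ s : ℝ≥0, s ≤ t → (δ : ℝ) ≤ ‖map U₀ s z - U₀ s‖ := fun s hs ↦ by
      have hsT : (s : WithTop ℝ≥0) < swallowingTime U₀ z :=
        lt_of_le_of_lt (WithTop.coe_le_coe.2 hs) hzt
      have h1 := hfar s ⟨s.coe_nonneg, NNReal.coe_le_coe.2 hs⟩
      rwa [Real.toNNReal_coe, ← map_eq_of_isSolution hU₀c hg hsT] at h1
    set E : ℝ := Real.exp (2 / ((δ : ℝ) / 2) ^ 2 * t) with hE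
    have hE1 : 1 ≤ E := Real.one_le_exp (by positivity)
    have hE0 : 0 < E := by positivity
    set ε : ℝ := (δ : ℝ) / (8 * E) with hε
    have hε0 : 0 < ε := by positivity
    have hεE : ε * E = δ / 8 := by
      rw [hε]
      field_simp
    have hεδ : ε ≤ δ / 4 := by
      have : ε ≤ ε * E := le_mul_of_one_le_right hε0.le hE1
      linarith
    refine ⟨ε, hε0, fun U hU z' hz' ↦ ?_⟩
    have hsmall : dist z' z * E + ε * (E - 1) < δ / 4 := by
      have h1 : dist z' z * E < ε * E := mul_lt_mul_of_pos_right hz' hE0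
      have h2 : ε * (E - 1) ≤ ε * E := by nlinarith
      linarith
    exact (dist_map_le_of_driving_close (z := z) (z' := z') hU₀c U.continuous hzt hδ hfar' hε0.le
      hεδ hU hsmall).1
  choose! ε hε hkey using key
  -- a finite subcover of `C`
  obtain ⟨T, hTC, hcov⟩ := hC.elim_nhds_subcover (fun z ↦ ball z (ε z)) fun z hz ↦
    ball_mem_nhds z (hε z hz)
  by_cases hT : T = ∅
  · -- `C` is empty
    rw [hT] at hcov
    simp only [Finset.notMem_empty, iUnion_of_empty, iUnion_empty, subset_empty_iff] at hcov
    refine Filter.mem_of_superset Filter.univ_mem fun U _ ↦ ?_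
    rw [mem_setOf_eq, hcov]
    exact disjoint_empty _
  have hTne : T.Nonempty := Finset.nonempty_iff_ne_empty.2 hT
  set ε₀ : ℝ := T.inf' hTne ε with hε₀
  have hε₀pos : 0 < ε₀ := (Finset.lt_inf'_iff hTne).2 fun z hz ↦ hε z (hTC z hz)
  have hε₀le : ∀ z ∈ T, ε₀ ≤ ε z := fun z hz ↦ Finset.inf'_le ε hz
  -- the uniform `ε₀`-tube around `U₀` over `[0, t]` is a neighbourhood of `U₀`
  set N : Set C(ℝ≥0, ℝ) := {U | ∀ s ∈ Icc (0 : ℝ≥0) t, dist (U₀ s) (U s) < ε₀} with hN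
  have hNnhds : N ∈ 𝓝 U₀ := by
    have hent : {fg : C(ℝ≥0, ℝ) × C(ℝ≥0, ℝ) | ∀ x ∈ Icc (0 : ℝ≥0) t,
        (fg.1 x, fg.2 x) ∈ {p : ℝ × ℝ | dist p.1 p.2 < ε₀}} ∈ uniformity C(ℝ≥0, ℝ) :=
      ContinuousMap.hasBasis_compactConvergenceUniformity.mem_of_mem
        (i := (Icc (0 : ℝ≥0) t, {p : ℝ × ℝ | dist p.1 p.2 < ε₀}))
        ⟨isCompact_Icc, Metric.dist_mem_uniformity hε₀pos⟩
    exact UniformSpace.ball_mem_nhds U₀ hent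
  refine Filter.mem_of_superset hNnhds fun U hU ↦ ?_
  refine Set.disjoint_left.2 fun w hw hwC ↦ ?_
  obtain ⟨z, hzT, hwz⟩ := mem_iUnion₂.1 (hcov hwC)
  have hclose : ∀ s : ℝ≥0, s ≤ t → |U₀ s - U s| ≤ ε z := fun s hs ↦ by
    have h1 := hU s ⟨zero_le, hs⟩
    rw [Real.dist_eq] at h1
    exact h1.le.trans (hε₀le z hzT)
  have halive := hkey z (hTC z hzT) U hclose w (mem_ball.1 hwz)
  exact absurd hw.2 (not_le.2 halive)

/-! ### Measurability of avoidance events for measurably parametrised driving functions -/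

section Measurable

variable {Ω : Type*} [MeasurableSpace Ω] {Φ : Ω → C(ℝ≥0, ℝ)}

/-- **`{ω | K_t(Φ ω) ∩ C = ∅}` is measurable** for `C ⊆ ℍ` compact, as soon as every value
`ω ↦ Φ ω s` of the (continuous) driving functions is measurable: `Φ` is then Borel measurable into
path space (`measurable_continuousMap_of_eval`) and the event is the preimage of an open set
(`isOpen_setOf_disjoint_hull`). [folklore] -/
theorem measurableSet_setOf_disjoint_hull (hΦ : ∀ s, Measurable fun ω ↦ Φ ω s) {C : Set ℂ}
    (hC : IsCompact C) (hCH : C ⊆ upperHalfPlaneSet) (t : ℝ≥0) :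
    MeasurableSet {ω | Disjoint (hull (Φ ω) t) C} := by
  have hm : Measurable[_, borel C(ℝ≥0, ℝ)] Φ :=
    Literature.Probability.Process.measurable_continuousMap_of_eval hΦ
  exact hm (MeasurableSpace.measurableSet_generateFrom (isOpen_setOf_disjoint_hull hC hCH t))

/-- A compact exhaustion of an open subset of the plane. [folklore] -/
theorem exists_iUnion_isCompact_eq_of_isOpen {O : Set ℂ} (hO : IsOpen O) :
    ∃ C : ℕ → Set ℂ, (∀ j, IsCompact (C j)) ∧ (∀ j, C j ⊆ O) ∧ ⋃ j, C j = O := by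
  obtain ⟨F, hFc, hFO, hFU, hFmono⟩ := hO.exists_iUnion_isClosed
  refine ⟨fun j ↦ F j ∩ closedBall 0 j, fun j ↦ (isCompact_closedBall _ _).of_isClosed_subset
    ((hFc j).inter isClosed_closedBall) inter_subset_right, fun j ↦ inter_subset_left.trans (hFO j), ?_⟩
  refine Subset.antisymm (iUnion_subset fun j ↦ inter_subset_left.trans (hFO j)) fun z hz ↦ ?_
  rw [← hFU] at hz
  obtain ⟨j₀, hj₀⟩ := mem_iUnion.1 hz
  obtain ⟨n, hn⟩ := exists_nat_ge ‖z‖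
  refine mem_iUnion.2 ⟨max j₀ n, hFmono (le_max_left _ _) hj₀, ?_⟩
  rw [mem_closedBall, dist_zero_right]
  exact hn.trans (by exact_mod_cast le_max_right j₀ n)

/-- The closure of a set misses a compact set iff the set misses a uniform neighbourhood of it.
[folklore] -/
theorem disjoint_closure_iff_exists_thickening {S A : Set ℂ} (hA : IsCompact A) :
    Disjoint (closure S) A ↔ ∃ n : ℕ, Disjoint S (thickening (1 / ((n : ℝ) + 1)) A) := by
  constructor
  · intro h
    obtain ⟨δ, hδ, hδS⟩ := hA.exists_thickening_subset_open isClosed_closure.isOpen_compl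
      (Set.disjoint_left.1 h.symm)
    obtain ⟨n, hn⟩ := exists_nat_one_div_lt hδ
    refine ⟨n, Set.disjoint_left.2 fun z hzS hzA ↦ ?_⟩
    exact hδS (thickening_mono hn.le A hzA) (subset_closure hzS)
  · rintro ⟨n, hn⟩
    exact (hn.closure_left isOpen_thickening).mono_right (self_subset_thickening (by positivity) A)

/-- **`{ω | cl K_∞(Φ ω) ∩ A = ∅}` is measurable** for `A` compact and a measurably parametrised
family of continuous driving functions: it is `⋃ₙ ⋂ₖ ⋂ⱼ {K_k(Φ ω) ∩ C^{n}_j = ∅}` for compact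
exhaustions `(C^{n}_j)_j` of the open subsets `(A)_{1/(n+1)} ∩ ℍ` of `ℍ` (the hulls lie in `ℍ`
and increase in time). This is the measurability implicit in "`K = F^{ℝ₊}_ℍ(cl K_∞)` is a random
element of `Ω₊`" ([LSW] Thm. 8.4 with §8.1: the σ-field generated by `{K ∩ A = ∅}`).
[cite: LawlerSchrammWerner2003Restriction, Thm. 8.4 (p. 37) with §8.1 (p. 31)] -/
theorem measurableSet_setOf_disjoint_closure_hullUnion (hΦ : ∀ s, Measurable fun ω ↦ Φ ω s)
    {A : Set ℂ} (hA : IsCompact A) :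
    MeasurableSet {ω | Disjoint (closure (hullUnion (Φ ω))) A} := by
  -- compact exhaustions of the open sets `(A)_{1/(n+1)} ∩ ℍ`
  have hex : ∀ n : ℕ, ∃ C : ℕ → Set ℂ, (∀ j, IsCompact (C j)) ∧
      (∀ j, C j ⊆ thickening (1 / ((n : ℝ) + 1)) A ∩ upperHalfPlaneSet) ∧
      ⋃ j, C j = thickening (1 / ((n : ℝ) + 1)) A ∩ upperHalfPlaneSet := fun n ↦
    exists_iUnion_isCompact_eq_of_isOpen (isOpen_thickening.inter isOpen_upperHalfPlaneSet)
  choose C hCc hCsub hCU using hex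
  have hrep : {ω | Disjoint (closure (hullUnion (Φ ω))) A} =
      ⋃ n : ℕ, ⋂ k : ℕ, ⋂ j : ℕ, {ω | Disjoint (hull (Φ ω) k) (C n j)} := by
    ext ω
    simp only [mem_setOf_eq, mem_iUnion, mem_iInter]
    rw [disjoint_closure_iff_exists_thickening hA]
    refine exists_congr fun n ↦ ?_
    rw [disjoint_hullUnion_iff]
    refine forall_congr' fun k ↦ ⟨fun h j ↦ h.mono_right ((hCsub n j).trans inter_subset_left),
      fun h ↦ Set.disjoint_left.2 fun z hz hzA ↦ ?_⟩
    have hz' : z ∈ thickening (1 / ((n : ℝ) + 1)) A ∩ upperHalfPlaneSet := ⟨hzA, hull_subset _ _ hz⟩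
    rw [← hCU n] at hz'
    obtain ⟨j, hj⟩ := mem_iUnion.1 hz'
    exact Set.disjoint_left.1 (h j) hz hj
  rw [hrep]
  exact MeasurableSet.iUnion fun n ↦ MeasurableSet.iInter fun k ↦ MeasurableSet.iInter fun j ↦
    measurableSet_setOf_disjoint_hull hΦ (hCc n j) ((hCsub n j).trans inter_subset_right) k

end Measurable

end Loewner

end Literature.Probability.RandomPlanarGeometry

end
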